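import Mathlib.LinearAlgebra.Matrix.Adjugate
import Mathlib.Algebra.BigOperators.Field
import Mathlib.Algebra.Field.Subfield.Basic
import Mathlib.Algebra.Order.Ring.Abs
import Mathlib.Tactic.FieldSimp
import HarnessLib

/-!
# Inverting a monomial change of variables with the adjugate ([CoP1] Prop. 9.3, (46) and (49); Cossart–Piltant 2019, proof of Prop. 4.6)

Topic: `Literature/AlgebraicGeometry/Resolution`. PROOF side of `CossartPiltant2019ReductionP`
(`ArithmeticalThreefoldsLocal.lean`), input (C4), decomposition layer of [CoP1] Prop. 9.3
(hypothesis `hDec` of `cossartPiltant2019ReductionP_of_cjs_of_stableInertiaHensel`). After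
Prop. 8.1 has made `f₁, …, f_r ∈ R₁ ⊂ K` monomials in the regular parameters of the local
uniformization `S′` of `V′`, the printed proof (HAL pp. 27–28) reads:

> For each `i`, `1 ≤ i ≤ r`, there is an expression `fᵢ = γᵢ ∏ⱼ xⱼ^{aᵢⱼ}`, where `γᵢ` is a
> unit in `S′`. … the matrix `A := (aᵢⱼ)` is nonsingular. After possibly permuting two of the
> `fᵢ`'s (if `r ≥ 2`), it can be assumed that `det A > 0`. Let `B =: (bᵢⱼ)` be the adjoint
> matrix of `A`, and let `Fᵢ := ∏ⱼ fⱼ^{bⱼᵢ} = (∏ⱼ γⱼ^{bⱼᵢ}) xᵢ^{det A} ∈ S′ ∩ K` (46) …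
> `G′ⱼ := gⱼ^{det A} / ∏ᵢ Fᵢ^{cᵢⱼ} = γ′ⱼ (g′ⱼ)^{det A} ∈ S′` (49)

(the same device is (5101)–(5102) in the proof of Cossart–Piltant 2019, Prop. 4.6 = arXiv v1
p. 53: "By elementary linear algebra, there exists an `r × r` matrix `M ∈ M(r, ℤ)`,
`a = det M > 0` such that `gⱼ := ∏ᵢ fᵢ^{mᵢⱼ} = δ̂ⱼ ûⱼ^a`"). This file proves the identities,
for elements of a field and integer exponents (`zpow`):

* `zpow_sum_of_ne_zero` — `a^{∑ nᵢ} = ∏ a^{nᵢ}` for `a ≠ 0`;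
* `prod_zpow_adjugate_eq` — PROVED, **(46)**: if `fᵢ = γᵢ ∏ⱼ xⱼ^{Aᵢⱼ}` with all `xⱼ ≠ 0`,
  then `∏ⱼ fⱼ^{(adj A)ᵢⱼ} = (∏ⱼ γⱼ^{(adj A)ᵢⱼ}) · xᵢ^{det A}` (`adj A · A = det A · 1`);
* `exists_prod_zpow_eq_mul_pow_natAbs_det` — PROVED, the sign normalization "it can be
  assumed that `det A > 0`": with `M := sign(det A) · adj A`,
  `∏ⱼ fⱼ^{Mᵢⱼ} = (∏ⱼ γⱼ^{Mᵢⱼ}) · xᵢ^{|det A|}`, a genuine power;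
* `pow_div_prod_pow_eq` — PROVED, **(49)**: if `Fᵢ = uᵢ xᵢ^d` and `g = g′ ∏ᵢ xᵢ^{cᵢ}` then
  `g^d / ∏ᵢ Fᵢ^{cᵢ} = (∏ᵢ uᵢ^{cᵢ})⁻¹ · g′^d`.

Everything is PROVED; no named facts, definitions, instances or notation are introduced.

## Sources

* V. Cossart, O. Piltant, J. Algebra 320 (2008) 1051–1082: proof of Prop. 9.3, (46) and (49)
  (HAL hal-00139124, pp. 27–28). [CossartPiltant2008]
* V. Cossart, O. Piltant, J. Algebra 529 (2019) = arXiv:1412.0868: proof of Prop. 4.6,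
  (5101)–(5102) (arXiv v1 p. 53). [CossartPiltant2019]
-/

namespace Literature.AlgebraicGeometry.Resolution

section Zpow

variable {L : Type*} [Field L]

/-- `a^{∑ᵢ nᵢ} = ∏ᵢ a^{nᵢ}` for a non-zero element of a field and integer exponents.
[cite: CossartPiltant2008, proof of Prop. 9.3, (46) (HAL p. 27)] -/
theorem zpow_sum_of_ne_zero {ι : Type*} {a : L} (ha : a ≠ 0) (s : Finset ι) (n : ι → ℤ) :
    a ^ (∑ i ∈ s, n i) = ∏ i ∈ s, a ^ (n i) := by
  classical
  induction s using Finset.induction_on with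
  | empty => simp
  | insert i s hi ih => rw [Finset.sum_insert hi, Finset.prod_insert hi, zpow_add₀ ha, ih]

variable {ι : Type*} [Fintype ι] [DecidableEq ι]

/-- **[CoP1] (46): inverting monomials with the adjugate.** If `fᵢ = γᵢ ∏ⱼ xⱼ^{Aᵢⱼ}` in a field
with all `xⱼ ≠ 0` and an integer matrix `A`, then for every `i`,
`∏ⱼ fⱼ^{(adj A)ᵢⱼ} = (∏ⱼ γⱼ^{(adj A)ᵢⱼ}) · xᵢ^{det A}`, because `adj A · A = det A · 1`.
[cite: CossartPiltant2008, proof of Prop. 9.3, (46) (HAL p. 27)]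
[cite: CossartPiltant2019, proof of Prop. 4.6, (5101) (arXiv v1 p. 53)] -/
theorem prod_zpow_adjugate_eq (A : Matrix ι ι ℤ) (x γ f : ι → L) (hx : ∀ j, x j ≠ 0)
    (hf : ∀ i, f i = γ i * ∏ j, x j ^ A i j) (i : ι) :
    ∏ j, f j ^ A.adjugate i j = (∏ j, γ j ^ A.adjugate i j) * x i ^ A.det := by
  have h1 : ∀ j, f j ^ A.adjugate i j =
      γ j ^ A.adjugate i j * ∏ k, x k ^ (A j k * A.adjugate i j) := by
    intro j
    rw [hf j, mul_zpow, ← Finset.prod_zpow]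
    congr 1
    exact Finset.prod_congr rfl (fun k _ => (zpow_mul _ _ _).symm)
  simp_rw [h1]
  rw [Finset.prod_mul_distrib, Finset.prod_comm]
  congr 1
  have h2 : ∀ k, ∏ j, x k ^ (A j k * A.adjugate i j) = x k ^ ((A.adjugate * A) i k) := by
    intro k
    rw [← zpow_sum_of_ne_zero (hx k), Matrix.mul_apply]
    congr 1
    exact Finset.sum_congr rfl (fun j _ => mul_comm _ _)
  simp_rw [h2, Matrix.adjugate_mul, Matrix.smul_apply, Matrix.one_apply, smul_eq_mul, mul_ite,
    mul_one, mul_zero]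
  rw [Finset.prod_eq_single i (fun k _ hk => by rw [if_neg (Ne.symm hk), zpow_zero])
    (fun h => absurd (Finset.mem_univ i) h), if_pos rfl]

/-- **"It can be assumed that `det A > 0`"**: with the sign-corrected adjugate
`M := sign(det A) · adj A` one gets a genuine (natural) power of `xᵢ`:
`∏ⱼ fⱼ^{Mᵢⱼ} = (∏ⱼ γⱼ^{Mᵢⱼ}) · xᵢ^{|det A|}`; if `det A ≠ 0` the exponent `|det A|` is
positive. [cite: CossartPiltant2008, proof of Prop. 9.3, (46) (HAL p. 27)]
[cite: CossartPiltant2019, proof of Prop. 4.6, (5101) (arXiv v1 p. 53)] -/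
theorem exists_prod_zpow_eq_mul_pow_natAbs_det (A : Matrix ι ι ℤ) (x γ f : ι → L)
    (hx : ∀ j, x j ≠ 0) (hf : ∀ i, f i = γ i * ∏ j, x j ^ A i j) :
    ∃ M : Matrix ι ι ℤ, ∀ i,
      ∏ j, f j ^ M i j = (∏ j, γ j ^ M i j) * x i ^ A.det.natAbs := by
  refine ⟨A.det.sign • A.adjugate, fun i => ?_⟩
  have key := prod_zpow_adjugate_eq A x γ f hx hf i
  have hs : ∀ (y : L) (j : ι), y ^ (A.det.sign • A.adjugate) i j = (y ^ A.adjugate i j) ^ A.det.sign := by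
    intro y j
    rw [Matrix.smul_apply, smul_eq_mul, mul_comm, zpow_mul]
  simp_rw [hs]
  rw [Finset.prod_zpow, Finset.prod_zpow, key, mul_zpow, ← zpow_mul]
  congr 1
  rw [← zpow_natCast]
  congr 1
  rw [mul_comm]
  exact Int.sign_mul_self_eq_natAbs A.det

omit [DecidableEq ι] in
/-- **[CoP1] (49): the companion identity for the strict transforms.** If `Fᵢ = uᵢ xᵢ^d`
(`uᵢ, xᵢ ≠ 0`) and `g = g′ ∏ᵢ xᵢ^{cᵢ}`, then `g^d / ∏ᵢ Fᵢ^{cᵢ} = (∏ᵢ uᵢ^{cᵢ})⁻¹ · g′^d` — a unit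
times `g′^d` when the `uᵢ` are units. [cite: CossartPiltant2008, proof of Prop. 9.3, (49) (HAL p. 28)]
[cite: CossartPiltant2019, proof of Prop. 4.6, (5102) (arXiv v1 p. 53)] -/
theorem pow_div_prod_pow_eq (d : ℕ) (x u F : ι → L) (c : ι → ℕ) (hx : ∀ i, x i ≠ 0)
    (hu : ∀ i, u i ≠ 0) (hF : ∀ i, F i = u i * x i ^ d) (g g' : L)
    (hg : g = g' * ∏ i, x i ^ c i) :
    g ^ d / ∏ i, F i ^ c i = (∏ i, u i ^ c i)⁻¹ * g' ^ d := by
  have hF' : ∏ i, F i ^ c i = (∏ i, u i ^ c i) * ∏ i, (x i ^ c i) ^ d := by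
    simp_rw [hF, mul_pow, Finset.prod_mul_distrib, ← pow_mul]
    congr 1
    exact Finset.prod_congr rfl (fun i _ => by rw [mul_comm])
  have hu' : (∏ i, u i ^ c i) ≠ 0 := Finset.prod_ne_zero_iff.mpr (fun i _ => pow_ne_zero _ (hu i))
  have hx' : (∏ i, (x i ^ c i) ^ d) ≠ 0 :=
    Finset.prod_ne_zero_iff.mpr (fun i _ => pow_ne_zero _ (pow_ne_zero _ (hx i)))
  rw [hF', hg, mul_pow, ← Finset.prod_pow]
  field_simp

end Zpow

end Literature.AlgebraicGeometry.Resolution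

/-! ## (46) in the frame: `Fᵢ ∈ S′ ∩ K`, a unit of `S′` times `xᵢ^{D}` -/

namespace Literature.AlgebraicGeometry.Resolution

section Frame

variable {E : Type*} [Field E]

/-- Integer powers of a unit of a subring stay in the subring and are units there. [folklore] -/
private theorem exists_unit_coe_eq_zpow (S' : Subring E) (γ : S'ˣ) (n : ℤ) :
    ∃ u : S'ˣ, ((u : S') : E) = ((γ : S') : E) ^ n := by
  rcases Int.eq_nat_or_neg n with ⟨m, rfl | rfl⟩
  · refine ⟨γ ^ m, ?_⟩
    rw [Units.val_pow_eq_pow_val, Subring.coe_pow, zpow_natCast]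
  · refine ⟨γ⁻¹ ^ m, ?_⟩
    rw [Units.val_pow_eq_pow_val, Subring.coe_pow, zpow_neg, zpow_natCast, ← inv_pow]
    congr 1
    have h : ((γ : S') : E) * (((γ⁻¹ : S'ˣ) : S') : E) = 1 := by
      rw [← Subring.coe_mul, Units.mul_inv, Subring.coe_one]
    exact eq_inv_of_mul_eq_one_right h

/-- A finite product of integer powers of units of a subring is (the image of) a unit of the
subring. [folklore] -/
private theorem exists_unit_coe_eq_prod_zpow (S' : Subring E) {ι : Type*} (s : Finset ι)
    (γ : ι → S'ˣ) (n : ι → ℤ) :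
    ∃ u : S'ˣ, ((u : S') : E) = ∏ j ∈ s, ((γ j : S') : E) ^ n j := by
  classical
  induction s using Finset.induction_on with
  | empty => exact ⟨1, by simp⟩
  | insert j s hj ih =>
    obtain ⟨u, hu⟩ := ih
    obtain ⟨w, hw⟩ := exists_unit_coe_eq_zpow S' (γ j) (n j)
    refine ⟨w * u, ?_⟩
    rw [Finset.prod_insert hj, Units.val_mul, Subring.coe_mul, hw, hu]

/-- **[CoP1] (46) in the frame: `Fᵢ := ∏ⱼ fⱼ^{bⱼᵢ} ∈ S′ ∩ K` is a unit of `S′` times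
`xᵢ^{det A}`.** Let `S′` be a subring and `K` a subfield of a field `E`; `x₁, …, x_r ∈ S′`
non-zero, `γᵢ` units of `S′`, `A` an integer matrix with `det A ≠ 0`, and `fᵢ ∈ K` with
`fᵢ = γᵢ ∏ⱼ xⱼ^{Aᵢⱼ}`. Then there are `D > 0` and `Fᵢ ∈ K` with `Fᵢ = uᵢ xᵢ^D`, `uᵢ` units of
`S′` (so `Fᵢ ∈ S′ ∩ K`). [cite: CossartPiltant2008, proof of Prop. 9.3, (46) (HAL p. 27)]
[cite: CossartPiltant2019, proof of Prop. 4.6, (5101) (arXiv v1 p. 53)] -/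
theorem exists_unit_mul_pow_mem_subfield (S' : Subring E) (K : Subfield E) {r : ℕ}
    (x : Fin r → S') (hx : ∀ j, ((x j : S') : E) ≠ 0) (γ : Fin r → S'ˣ)
    (A : Matrix (Fin r) (Fin r) ℤ) (hA : A.det ≠ 0) (f : Fin r → E) (hfK : ∀ i, f i ∈ K)
    (hf : ∀ i, f i = ((γ i : S') : E) * ∏ j, ((x j : S') : E) ^ A i j) :
    ∃ (D : ℕ) (_ : 0 < D) (F : Fin r → E) (u : Fin r → S'ˣ),
      (∀ i, F i ∈ K) ∧ ∀ i, F i = ((u i : S') : E) * ((x i : S') : E) ^ D := by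
  classical
  obtain ⟨M', hM'⟩ := exists_prod_zpow_eq_mul_pow_natAbs_det A (fun j => ((x j : S') : E))
    (fun j => ((γ j : S') : E)) f hx hf
  have hunit : ∀ i, ∃ u : S'ˣ, ((u : S') : E) = ∏ j, ((γ j : S') : E) ^ M' i j := fun i =>
    exists_unit_coe_eq_prod_zpow S' Finset.univ γ (fun j => M' i j)
  choose u hu using hunit
  refine ⟨A.det.natAbs, Int.natAbs_pos.mpr hA, fun i => ∏ j, f j ^ M' i j, u,
    fun i => ?_, fun i => ?_⟩
  · exact prod_mem (fun j _ => zpow_mem (hfK j) _)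
  · change ∏ j, f j ^ M' i j = _
    rw [hM' i, hu i]

end Frame

end Literature.AlgebraicGeometry.Resolution
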